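import Summits.QuantumFields.YangMills.Theorems.AllWindowsColdBoxBoxHighLinePlaqSourceRest
import Summits.QuantumFields.YangMills.Theorems.AllWindowsColdBoxBoxHighLineSkinRow

/-!
# LINE-20 U1b/U1c — two plaquette sources through the rest Green function: `|λ_p|restᵀ · (K^rel)⁻¹ · λ_q|rest| ≲ (1+d)⁻⁴` (input `a₃`)

For the instantiation of ✓`schur_jaffard_dipole_decay` (`…AllWindowsColdBoxSchurJaffardGradient`; U1c `LandauDipoleDecay` of
⟨stmt-QuantumFields-24336⟩) — and, through the skin rows `hodgeQ s r = Σ_q λ_q(s)λ_q(r)`, for the Hessian-type input `a₂` of U1b — the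
DIPOLE–DIPOLE quantity `λ_p|restᵀ (restInv H) λ_q|rest` (`p = (x,j,k)`, `q = (x',j',k')`) is a signed sum of four MIXED SECOND DIFFERENCES of
w2's two-sided rest kernel `Kx` (✓`…BoxHighLineSkinRow`), one per pair (direction block of `p`) × (direction block of `q`), so
✓`Kx_hessian_bound` bounds it:
* `sum_restInv_mul_ite_eq_Kx` — the `restInv`-row against the indicator of an edge `(y, μ)` is `[dir r = μ]·Kx_μ(base r, y)`;
* `sum_ite_mul_apply` — a sum over rest links against the indicator of `(a, i)` evaluates a function vanishing off the rest links;
* `restInv_mulVec_landauCoeff_eq` — `(restInv *ᵥ λ_q|rest)(r)` in closed form;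
* **`landauCoeff_restInv_landauCoeff_decay`** — `|λ_p|rest ⬝ᵥ (restInv H *ᵥ λ_q|rest)|·(1 + |x_κ − x'_κ|)⁴ ≤ C` for all `H ≥ 1`, `p`, `q`, `κ`
  (uniform, no logarithm).
No definitions; standard axioms.

HONEST LABEL: helper toward the OPEN stub U1 `stub_landauKernelPackage` of a critic-stamped DRAFT line on the R2ξ″ crux; no stub, crux, rung or summit is
proved here; the Yang–Mills mass gap is NOT proved by this file.
-/

set_option autoImplicit false

noncomputable section

namespace Summit.QuantumFields.YangMills.Theorems.AllWindowsColdBoxBoxHighLine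

open Finset Matrix
open Literature.Probability.LatticeModels (Site)
open Literature.MathematicalPhysics.QuantumFieldTheory
open Literature.MathematicalPhysics.QuantumFieldTheory.LatticeMaxwell
open Literature.MathematicalPhysics.QuantumFieldTheory.AxialGauge
open Summit.QuantumFields.YangMills.Theorems.WeakCouplingRates
open Summit.QuantumFields.YangMills.Theorems.AllWindowsColdBox.BoxKernel
open RestBlock

namespace PlaqSource

variable {H : ℕ}

/-! ## Rows of `restInv` and sums over rest links in closed form -/

/-- The `restInv`-row of `r` against the indicator of the edge `(y, μ)` is `[dir r = μ]·Kx_μ(base r, y)`. -/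
theorem sum_restInv_mul_ite_eq_Kx [NeZero H] (r : Rest H) (y : Site 4) (μ : Fin 4) :
    ∑ r' : Rest H, restInv H r r' * (if r'.1.1.1 = (y, μ) then (1 : ℝ) else 0) =
      if r.1.1.1.2 = μ then Kx H μ r.1.1.1.1 y else 0 := by
  haveI : NeZero (2 * H) := ⟨by have := NeZero.ne H; omega⟩
  by_cases hdir : r.1.1.1.2 = μ
  · rw [if_pos hdir]
    subst hdir
    rw [← restKer_eq_Kx]
    by_cases h : IsRest H y r.1.1.1.2
    · rw [sum_restInv_mul_ite_eq r _ _ (ofBox_toBox_edge _ y h), restInv_ofBox r rfl]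
      unfold restKer
      rw [dif_pos h]
    · rw [sum_restInv_mul_ite_eq_zero r _ (fun r' hr' => h (isRest_of_edge_eq r' hr')), restKer_of_not_isRest r h]
  · rw [if_neg hdir, sum_restInv_mul_ite_eq_zero_of_ne r _ hdir]

/-- A sum over the rest links against the indicator of `(a, i)` evaluates any function of (base, direction) vanishing off the rest links. -/
theorem sum_ite_mul_apply (Φ : Site 4 → Fin 4 → ℝ) (hΦ : ∀ a i, ¬ IsRest H a i → Φ a i = 0) (a : Site 4) (i : Fin 4) :
    ∑ r : Rest H, (if r.1.1.1 = (a, i) then (1 : ℝ) else 0) * Φ r.1.1.1.1 r.1.1.1.2 = Φ a i := by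
  by_cases h : IsRest H a i
  · rw [Finset.sum_eq_single (ofBox i (toBox i a h))]
    · rw [if_pos (ofBox_toBox_edge i a h)]
      have h1 : (ofBox i (toBox i a h)).1.1.1.1 = a := congrArg Prod.fst (ofBox_toBox_edge i a h)
      have h2 : (ofBox i (toBox i a h)).1.1.1.2 = i := congrArg Prod.snd (ofBox_toBox_edge i a h)
      rw [h1, h2, one_mul]
    · intro r _ hne
      rw [if_neg, zero_mul]
      intro hr
      exact hne (rest_ext (hr.trans (ofBox_toBox_edge i a h).symm))
    · intro hr; exact absurd (Finset.mem_univ _) hr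
  · rw [hΦ a i h]
    exact Finset.sum_eq_zero fun r _ => by
      rw [if_neg, zero_mul]
      intro hr
      exact h (isRest_of_edge_eq r hr)

/-- **`(restInv *ᵥ λ_q|rest)(r)` in closed form** (`q = (x', j', k')`): the two pairs of `q` read through the two-sided kernel of the direction of `r`. -/
theorem restInv_mulVec_landauCoeff_eq [NeZero H] (x' : Site 4) (j' k' : Fin 4) (r : Rest H) :
    (restInv H *ᵥ fun r' : Rest H => landauCoeff H (x', j', k') r'.1) r =
      ((if r.1.1.1.2 = j' then Kx H j' r.1.1.1.1 x' else 0) - (if r.1.1.1.2 = j' then Kx H j' r.1.1.1.1 (x' + Pi.single k' 1) else 0)) -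
      ((if r.1.1.1.2 = k' then Kx H k' r.1.1.1.1 x' else 0) - (if r.1.1.1.2 = k' then Kx H k' r.1.1.1.1 (x' + Pi.single j' 1) else 0)) := by
  have hexp : (restInv H *ᵥ fun r' : Rest H => landauCoeff H (x', j', k') r'.1) r =
      ((∑ r' : Rest H, restInv H r r' * (if r'.1.1.1 = (x', j') then (1 : ℝ) else 0)) -
        (∑ r' : Rest H, restInv H r r' * (if r'.1.1.1 = (x' + Pi.single k' 1, j') then (1 : ℝ) else 0))) -
      ((∑ r' : Rest H, restInv H r r' * (if r'.1.1.1 = (x', k') then (1 : ℝ) else 0)) -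
        (∑ r' : Rest H, restInv H r r' * (if r'.1.1.1 = (x' + Pi.single j' 1, k') then (1 : ℝ) else 0))) := by
    simp only [Matrix.mulVec, dotProduct, landauCoeff_apply, coeffAux, mul_add, mul_sub, Finset.sum_add_distrib, Finset.sum_sub_distrib]
    ring
  rw [hexp, sum_restInv_mul_ite_eq_Kx, sum_restInv_mul_ite_eq_Kx, sum_restInv_mul_ite_eq_Kx, sum_restInv_mul_ite_eq_Kx]

/-! ## The dipole–dipole estimate `a₃` -/

/-- `|A + B|·w ≤ 2C` from `|A|·w ≤ C`, `|B|·w ≤ C`. -/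
theorem abs_add_mul_le_two {A B w C : ℝ} (hw : 0 ≤ w) (h1 : |A| * w ≤ C) (h2 : |B| * w ≤ C) : |A + B| * w ≤ 2 * C := by
  have := abs_add_le A B
  nlinarith [abs_nonneg A, abs_nonneg B]

/-- One pair of `p` against the two pairs of `q`: `|Φ(z, i) − Φ(z + e_ν, i)|·(1+|z_κ − x'_κ|)⁴ ≤ 2C`, where `Φ` is the closed form of
`restInv *ᵥ λ_q|rest` and `ν ≠ i` (✓`Kx_hessian_bound`, one Hessian per matching direction). -/
theorem pair_against_source_bound : ∃ C : ℝ, 0 ≤ C ∧ ∀ (H : ℕ) [NeZero H] (x' : Site 4) (j' k' : Fin 4), j' ≠ k' →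
    ∀ (z : Site 4) (i ν κ : Fin 4), ν ≠ i →
    |(((if i = j' then Kx H j' z x' else 0) - (if i = j' then Kx H j' z (x' + Pi.single k' 1) else 0)) -
        ((if i = k' then Kx H k' z x' else 0) - (if i = k' then Kx H k' z (x' + Pi.single j' 1) else 0))) -
      (((if i = j' then Kx H j' (z + Pi.single ν 1) x' else 0) - (if i = j' then Kx H j' (z + Pi.single ν 1) (x' + Pi.single k' 1) else 0)) -
        ((if i = k' then Kx H k' (z + Pi.single ν 1) x' else 0) -
          (if i = k' then Kx H k' (z + Pi.single ν 1) (x' + Pi.single j' 1) else 0)))| *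
      (1 + |((z κ - x' κ : ℤ) : ℝ)|) ^ 4 ≤ C := by
  obtain ⟨C, hC0, hC⟩ := Kx_hessian_bound
  refine ⟨2 * C, by positivity, ?_⟩
  intro H _ x' j' k' hjk' z i ν κ hνi
  haveI : NeZero (2 * H) := ⟨by have := NeZero.ne H; omega⟩
  have hw0 : 0 ≤ (1 + |((z κ - x' κ : ℤ) : ℝ)|) ^ 4 := by positivity
  -- regroup into the two Hessians
  have hre : (((if i = j' then Kx H j' z x' else 0) - (if i = j' then Kx H j' z (x' + Pi.single k' 1) else 0)) -
        ((if i = k' then Kx H k' z x' else 0) - (if i = k' then Kx H k' z (x' + Pi.single j' 1) else 0))) -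
      (((if i = j' then Kx H j' (z + Pi.single ν 1) x' else 0) - (if i = j' then Kx H j' (z + Pi.single ν 1) (x' + Pi.single k' 1) else 0)) -
        ((if i = k' then Kx H k' (z + Pi.single ν 1) x' else 0) -
          (if i = k' then Kx H k' (z + Pi.single ν 1) (x' + Pi.single j' 1) else 0))) =
      (if i = j' then (Kx H j' (z + Pi.single ν 1) (x' + Pi.single k' 1) - Kx H j' (z + Pi.single ν 1) x' -
          Kx H j' z (x' + Pi.single k' 1) + Kx H j' z x') else 0) -
      (if i = k' then (Kx H k' (z + Pi.single ν 1) (x' + Pi.single j' 1) - Kx H k' (z + Pi.single ν 1) x' -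
          Kx H k' z (x' + Pi.single j' 1) + Kx H k' z x') else 0) := by
    split_ifs <;> ring
  rw [hre]
  have hA : |(if i = j' then (Kx H j' (z + Pi.single ν 1) (x' + Pi.single k' 1) - Kx H j' (z + Pi.single ν 1) x' -
      Kx H j' z (x' + Pi.single k' 1) + Kx H j' z x') else 0)| * (1 + |((z κ - x' κ : ℤ) : ℝ)|) ^ 4 ≤ C := by
    by_cases hij : i = j'
    · rw [if_pos hij]
      subst hij
      exact hC H i ν k' κ hνi (Ne.symm hjk') z x'
    · rw [if_neg hij, abs_zero, zero_mul]; exact hC0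
  have hB : |(if i = k' then (Kx H k' (z + Pi.single ν 1) (x' + Pi.single j' 1) - Kx H k' (z + Pi.single ν 1) x' -
      Kx H k' z (x' + Pi.single j' 1) + Kx H k' z x') else 0)| * (1 + |((z κ - x' κ : ℤ) : ℝ)|) ^ 4 ≤ C := by
    by_cases hik : i = k'
    · rw [if_pos hik]
      subst hik
      exact hC H i ν j' κ hνi hjk' z x'
    · rw [if_neg hik, abs_zero, zero_mul]; exact hC0
  exact abs_sub_mul_le_two hw0 hA hB

/-- **`a₃` for two plaquette sources**: `|λ_p|rest ⬝ᵥ (restInv H *ᵥ λ_q|rest)|·(1 + |x_κ − x'_κ|)⁴ ≤ C` for all `H ≥ 1`, plaquettes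
`p = (x,j,k)`, `q = (x',j',k')` and coordinates `κ` — uniformly, no logarithm. -/
theorem landauCoeff_restInv_landauCoeff_decay : ∃ C : ℝ, 0 ≤ C ∧ ∀ (H : ℕ) [NeZero H] (p q : Plaq 4) (κ : Fin 4),
    |(fun r : Rest H => landauCoeff H p r.1) ⬝ᵥ (restInv H *ᵥ fun r : Rest H => landauCoeff H q r.1)| *
      (1 + |((p.1 κ - q.1 κ : ℤ) : ℝ)|) ^ 4 ≤ C := by
  obtain ⟨C, hC0, hC⟩ := pair_against_source_bound
  refine ⟨2 * (8 * C), by positivity, ?_⟩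
  rintro H _ ⟨x, j, k⟩ ⟨x', j', k'⟩ κ
  haveI : NeZero (2 * H) := ⟨by have := NeZero.ne H; omega⟩
  change |(fun r : Rest H => landauCoeff H (x, j, k) r.1) ⬝ᵥ (restInv H *ᵥ fun r : Rest H => landauCoeff H (x', j', k') r.1)| *
      (1 + |((x κ - x' κ : ℤ) : ℝ)|) ^ 4 ≤ 2 * (8 * C)
  have hw0 : 0 ≤ (1 + |((x κ - x' κ : ℤ) : ℝ)|) ^ 4 := by positivity
  -- degenerate plaquettes carry the zero source
  by_cases hjk : j = k
  · subst hjk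
    have h0 : (fun r : Rest H => landauCoeff H (x, j, j) r.1) = 0 := by
      funext r; simp only [landauCoeff_apply, coeffAux, Pi.zero_apply]; ring
    rw [h0, zero_dotProduct, abs_zero, zero_mul]; positivity
  by_cases hjk' : j' = k'
  · subst hjk'
    have h0 : (fun r : Rest H => landauCoeff H (x', j', j') r.1) = 0 := by
      funext r; simp only [landauCoeff_apply, coeffAux, Pi.zero_apply]; ring
    rw [h0, Matrix.mulVec_zero, dotProduct_zero, abs_zero, zero_mul]; positivity
  -- the closed form of the column
  set Φ : Site 4 → Fin 4 → ℝ := fun a i =>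
    ((if i = j' then Kx H j' a x' else 0) - (if i = j' then Kx H j' a (x' + Pi.single k' 1) else 0)) -
      ((if i = k' then Kx H k' a x' else 0) - (if i = k' then Kx H k' a (x' + Pi.single j' 1) else 0)) with hΦ
  have hcol : (restInv H *ᵥ fun r : Rest H => landauCoeff H (x', j', k') r.1) = fun r : Rest H => Φ r.1.1.1.1 r.1.1.1.2 := by
    funext r; exact restInv_mulVec_landauCoeff_eq x' j' k' r
  have hΦ0 : ∀ a i, ¬ IsRest H a i → Φ a i = 0 := by
    intro a i ha
    simp only [hΦ]
    by_cases hij : i = j'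
    · subst hij
      rw [Kx_of_not_isRest_fst ha, Kx_of_not_isRest_fst ha]
      by_cases hik : i = k'
      · exact absurd hik hjk'
      · simp [hik]
    · by_cases hik : i = k'
      · subst hik
        rw [Kx_of_not_isRest_fst ha, Kx_of_not_isRest_fst ha]
        simp [hij]
      · simp [hij, hik]
  -- the pairing: four indicator sums
  have hpair : (fun r : Rest H => landauCoeff H (x, j, k) r.1) ⬝ᵥ (fun r : Rest H => Φ r.1.1.1.1 r.1.1.1.2) =
      (Φ x j - Φ (x + Pi.single k 1) j) + (Φ (x + Pi.single j 1) k - Φ x k) := by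
    simp only [dotProduct, landauCoeff_apply, coeffAux, add_mul, sub_mul, Finset.sum_add_distrib, Finset.sum_sub_distrib,
      sum_ite_mul_apply Φ hΦ0]
    ring
  rw [hcol, hpair]
  -- re-anchor the second pair (base `x + e_j`) to `x`
  have h1 : |Φ x j - Φ (x + Pi.single k 1) j| * (1 + |((x κ - x' κ : ℤ) : ℝ)|) ^ 4 ≤ 8 * C := by
    have h := hC H x' j' k' hjk' x j k κ (Ne.symm hjk)
    simp only [hΦ] at h ⊢
    linarith [mul_nonneg (abs_nonneg ((((if j = j' then Kx H j' x x' else 0) - (if j = j' then Kx H j' x (x' + Pi.single k' 1) else 0)) -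
      ((if j = k' then Kx H k' x x' else 0) - (if j = k' then Kx H k' x (x' + Pi.single j' 1) else 0))) -
      (((if j = j' then Kx H j' (x + Pi.single k 1) x' else 0) - (if j = j' then Kx H j' (x + Pi.single k 1) (x' + Pi.single k' 1) else 0)) -
        ((if j = k' then Kx H k' (x + Pi.single k 1) x' else 0) -
          (if j = k' then Kx H k' (x + Pi.single k 1) (x' + Pi.single j' 1) else 0))))) hw0]
  have h2 : |Φ (x + Pi.single j 1) k - Φ x k| * (1 + |((x κ - x' κ : ℤ) : ℝ)|) ^ 4 ≤ 8 * C := by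
    have h := hC H x' j' k' hjk' x k j κ hjk
    rw [abs_sub_comm]
    simp only [hΦ] at h ⊢
    linarith [mul_nonneg (abs_nonneg ((((if k = j' then Kx H j' x x' else 0) - (if k = j' then Kx H j' x (x' + Pi.single k' 1) else 0)) -
      ((if k = k' then Kx H k' x x' else 0) - (if k = k' then Kx H k' x (x' + Pi.single j' 1) else 0))) -
      (((if k = j' then Kx H j' (x + Pi.single j 1) x' else 0) - (if k = j' then Kx H j' (x + Pi.single j 1) (x' + Pi.single k' 1) else 0)) -
        ((if k = k' then Kx H k' (x + Pi.single j 1) x' else 0) -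
          (if k = k' then Kx H k' (x + Pi.single j 1) (x' + Pi.single j' 1) else 0))))) hw0]
  exact abs_add_mul_le_two hw0 h1 h2

end PlaqSource

end Summit.QuantumFields.YangMills.Theorems.AllWindowsColdBoxBoxHighLine

end
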